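import Mathlib
import Summits.ValiantsHypothesis.ValiantsHypothesis.Theorems.RigidityForcesSymmetryRankRigidMinimalReprLaplaceFiveSeparatedCaptureCommonLinePlaneDiag
import Summits.ValiantsHypothesis.ValiantsHypothesis.Theorems.RigidityForcesSymmetryRankRigidMinimalReprLaplaceFiveSeparatedCaptureLineInTwoPlanes
import Summits.ValiantsHypothesis.ValiantsHypothesis.Theorems.RigidityForcesSymmetryRankRigidMinimalReprLaplaceFiveSeparatedCaptureTwoTerm
import Summits.ValiantsHypothesis.ValiantsHypothesis.Theorems.RigidityForcesSymmetryRankRigidMinimalReprLaplaceFiveSeparatedCaptureBinaryNet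
import Summits.ValiantsHypothesis.ValiantsHypothesis.Theorems.RigidityForcesSymmetryRankRigidMinimalReprLaplaceFiveSeparatedCaptureTwoBinaryPlanes
import Summits.ValiantsHypothesis.ValiantsHypothesis.Theorems.RigidityForcesSymmetryRankRigidMinimalReprLaplaceFiveSeparatedCaptureLinesK1

/-!
# ValiantsHypothesis / RigidityForcesSymmetry — crux `LaplaceOptimalFive` (stmt-ValiantsHypothesis-24813), symmetric capture:
# ★★ **PAIR-MONOMIAL LINE `u = x_i x_j`: DIAGONAL-FREE PROLONGATIONS AND PROLONGATION 4 FORCE THE BLOCK `{i,j}²`**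

Brick 3 (part 11a) of the K1 lane (val-port-2 g6, 2026-08-29).  `u` is a pair monomial: `u_{pq} ≠ 0` only for `{p,q} = {i,j}`.  Two located
lemmas of the common-line note (rev 8), typed (the assembly is part 11b, `…CommonLinePairMonomial`):
* (P1) `diagFree_prolong_eq_zero_of_offBlock` — if `c` has an entry outside the block `{i,j} × {i,j}`, then `prolong ⟨u, c⟩` has NO
  nonzero diagonal-free element.  (Slices `G_p = λ_p u + μ_p c`.  A diagonal entry `c_{q₀q₀} ≠ 0` off `{i,j}` gives `μ_{q₀} = 0` and
  `c_{q₀q₀}·μ = λ_{q₀}·u_{q₀} = 0`, so `μ = 0`, `G = u ⊠ λ`, `λ = 0` by ✓ `rankOne_of_tensor_symm` (`diagFree_prolong_eq_zero_of_diag_off`);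
  a diagonal entry `c_{ii} ≠ 0` gives `μ ∝ e_j`, and reading `G(i,q,·) = G(q,i,·)`, `G(j,q,·) = G(q,j,·)` for `q ∉ {i,j}` kills row `q`
  of `c` (`offBlock_zero_of_diagFree_prolong`); a zero-diagonal `c` makes every prolongation square-free, ✓ `prolong_sup_sqfree_eq_zero`.)
* (P2) `block_of_four_le_finrank_prolong` — if `prolong(⟨u,a⟩ ⊔ ⟨u,b⟩)` has finrank ≥ 4 then `a` and `b` are block-supported
  (✓BN `exists_rows_le_two_of_finrank_prolong`: the rows lie in a plane containing `u_i = u_{ij}e_j`, `u_j = u_{ij}e_i`).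
Census of record: p₀(⟨x₀x₁, c⟩) = 1 ⇒ c block-supported in 86 368/86 368 sampled planes (`p1census.py`).

Honest framing.  Lemmas only; `CaptureIneqSym` in general, K1 on `K₃ ⊔ K₂`, `LaplaceOptimalFive` (OPEN · CONTESTED 72/120),
`RankRigidMinimalRepr` and `VP ≠ VNP` are NOT proved here.  No definitions, no `sorry`.
-/

set_option linter.dupNamespace false
set_option autoImplicit false

namespace Summit.ValiantsHypothesis.ValiantsHypothesis.Theorems.RigidityForcesSymmetryRankRigidMinimalRepr

namespace LaplaceFiveSeparatedCapture

open Finset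


/-- (P1, diagonal entry off the pair) `u` a pair monomial on `{i,j}`, `c_{q₀q₀} ≠ 0` with `q₀ ∉ {i,j}`: every diagonal-free element of
`prolong ⟨u, c⟩` vanishes. [folklore] -/
theorem diagFree_prolong_eq_zero_of_diag_off (u c : Fin 5 → Fin 5 → ℂ) (hu : ∀ p q, u p q = u q p)
    (i j : Fin 5) (hij : i ≠ j) (huij : u i j ≠ 0) (hoff : ∀ p q : Fin 5, u p q ≠ 0 → (p = i ∧ q = j) ∨ (p = j ∧ q = i))
    (q₀ : Fin 5) (hqi : q₀ ≠ i) (hqj : q₀ ≠ j) (hcq : c q₀ q₀ ≠ 0)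
    (G : Fin 5 → Fin 5 → Fin 5 → ℂ) (hG : G ∈ prolong (Submodule.span ℂ ({u, c} : Set (Fin 5 → Fin 5 → ℂ))))
    (hdf : ∀ p : Fin 5, G p p p = 0) : G = 0 := by
  classical
  have hud : ∀ q, u q q = 0 := fun q => by
    by_contra h
    rcases hoff q q h with ⟨h1, h2⟩ | ⟨h1, h2⟩
    · exact hij (h1.symm.trans h2)
    · exact hij (h2.symm.trans h1)
  have hrowq : ∀ r, u q₀ r = 0 := fun r => by
    by_contra h
    rcases hoff q₀ r h with ⟨h1, -⟩ | ⟨h1, -⟩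
    · exact hqi h1
    · exact hqj h1
  rw [mem_prolong_iff] at hG
  obtain ⟨h1, h2, hsl⟩ := hG
  have hco : ∀ p, ∃ l m : ℂ, l • u + m • c = G p := fun p => Submodule.mem_span_pair.mp (hsl p)
  choose lam mu hlm using hco
  have hcf : ∀ p q r, G p q r = lam p * u q r + mu p * c q r := fun p q r => by
    have e := congrFun (congrFun (hlm p) q) r
    simp only [Pi.add_apply, Pi.smul_apply, smul_eq_mul] at e
    exact e.symm
  have hmu0 : mu q₀ = 0 := by
    have e := hdf q₀
    rw [hcf, hud q₀, mul_zero, zero_add] at e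
    rcases mul_eq_zero.mp e with h | h
    · exact h
    · exact absurd h hcq
  have hmu : ∀ p, mu p = 0 := fun p => by
    have e1 : G p q₀ q₀ = lam p * u q₀ q₀ + mu p * c q₀ q₀ := hcf p q₀ q₀
    have e2 : G p q₀ q₀ = G q₀ q₀ p := by rw [h1 p q₀ q₀, h2 q₀ p q₀]
    rw [e2, hcf, hmu0, hud q₀, hrowq p] at e1
    have e3 : mu p * c q₀ q₀ = 0 := by linear_combination -e1
    rcases mul_eq_zero.mp e3 with h | h
    · exact h
    · exact absurd h hcq
  have hlam : ∀ p, lam p = 0 := by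
    by_contra hne
    push Not at hne
    obtain ⟨r₀, hr₀⟩ := hne
    have hsym : ∀ p q r, u p q * lam r = u p r * lam q := fun p q r => by
      have e1 : G r p q = lam r * u p q := by rw [hcf, hmu r, zero_mul, add_zero]
      have e2 : G q p r = lam q * u p r := by rw [hcf, hmu q, zero_mul, add_zero]
      have e3 : G r p q = G q p r := by rw [h1 r p q, h2 p r q, h1 p q r]
      rw [e1, e2] at e3
      linear_combination e3
    have key := rankOne_of_tensor_symm u lam hu hsym r₀ hr₀
    apply huij
    rw [key i j, hud r₀]
    simp
  funext p q r
  rw [hcf, hmu p, hlam p]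
  simp

/-- (P1, diagonal entry on the pair) `u` a pair monomial on `{i,j}`, `c_{ii} ≠ 0`: a NONZERO diagonal-free element of `prolong ⟨u, c⟩`
forces `c` to be supported on the block `{i,j} × {i,j}` (rows outside `{i,j}` vanish). [folklore] -/
theorem offBlock_zero_of_diagFree_prolong (u c : Fin 5 → Fin 5 → ℂ) (hu : ∀ p q, u p q = u q p)
    (i j : Fin 5) (hij : i ≠ j) (huij : u i j ≠ 0) (hoff : ∀ p q : Fin 5, u p q ≠ 0 → (p = i ∧ q = j) ∨ (p = j ∧ q = i))
    (hci : c i i ≠ 0)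
    (G : Fin 5 → Fin 5 → Fin 5 → ℂ) (hG : G ∈ prolong (Submodule.span ℂ ({u, c} : Set (Fin 5 → Fin 5 → ℂ))))
    (hdf : ∀ p : Fin 5, G p p p = 0) (hG0 : G ≠ 0) :
    ∀ q r : Fin 5, q ≠ i → q ≠ j → c q r = 0 := by
  classical
  have hud : ∀ q, u q q = 0 := fun q => by
    by_contra h
    rcases hoff q q h with ⟨h1, h2⟩ | ⟨h1, h2⟩
    · exact hij (h1.symm.trans h2)
    · exact hij (h2.symm.trans h1)
  have hrow : ∀ q r, q ≠ i → q ≠ j → u q r = 0 := fun q r hqi hqj => by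
    by_contra h
    rcases hoff q r h with ⟨h1, -⟩ | ⟨h1, -⟩
    · exact hqi h1
    · exact hqj h1
  have hui : ∀ r, r ≠ j → u i r = 0 := fun r hr => by
    by_contra h
    rcases hoff i r h with ⟨-, h2⟩ | ⟨h1, -⟩
    · exact hr h2
    · exact hij h1
  rw [mem_prolong_iff] at hG
  obtain ⟨h1, h2, hsl⟩ := hG
  have hco : ∀ p, ∃ l m : ℂ, l • u + m • c = G p := fun p => Submodule.mem_span_pair.mp (hsl p)
  choose lam mu hlm using hco
  have hcf : ∀ p q r, G p q r = lam p * u q r + mu p * c q r := fun p q r => by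
    have e := congrFun (congrFun (hlm p) q) r
    simp only [Pi.add_apply, Pi.smul_apply, smul_eq_mul] at e
    exact e.symm
  -- `μ_i = 0` and `μ_p = 0` for `p ≠ j`
  have hmui : mu i = 0 := by
    have e := hdf i
    rw [hcf, hud i, mul_zero, zero_add] at e
    rcases mul_eq_zero.mp e with h | h
    · exact h
    · exact absurd h hci
  have hmu : ∀ p, p ≠ j → mu p = 0 := fun p hpj => by
    have e1 : G p i i = lam p * u i i + mu p * c i i := hcf p i i
    have e2 : G p i i = G i i p := by rw [h1 p i i, h2 i p i]
    rw [e2, hcf, hmui, hud i, hui p hpj] at e1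
    have e3 : mu p * c i i = 0 := by linear_combination -e1
    rcases mul_eq_zero.mp e3 with h | h
    · exact h
    · exact absurd h hci
  -- `μ_j ≠ 0`, else `G = u ⊠ λ` and `G = 0`
  have hmuj : mu j ≠ 0 := by
    intro hmj
    have hmu' : ∀ p, mu p = 0 := fun p => by
      by_cases hpj : p = j
      · rw [hpj]; exact hmj
      · exact hmu p hpj
    have hlam : ∀ p, lam p = 0 := by
      by_contra hne
      push Not at hne
      obtain ⟨r₀, hr₀⟩ := hne
      have hsym : ∀ p q r, u p q * lam r = u p r * lam q := fun p q r => by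
        have e1 : G r p q = lam r * u p q := by rw [hcf, hmu' r, zero_mul, add_zero]
        have e2 : G q p r = lam q * u p r := by rw [hcf, hmu' q, zero_mul, add_zero]
        have e3 : G r p q = G q p r := by rw [h1 r p q, h2 p r q, h1 p q r]
        rw [e1, e2] at e3
        linear_combination e3
      have key := rankOne_of_tensor_symm u lam hu hsym r₀ hr₀
      apply huij
      rw [key i j, hud r₀]
      simp
    apply hG0
    funext p q r
    rw [hcf, hmu' p, hlam p]
    simp
  -- `λ_q = 0` for `q ∉ {i,j}`: read `G(i,q,j) = G(q,i,j)`
  have hlam : ∀ q, q ≠ i → q ≠ j → lam q = 0 := fun q hqi hqj => by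
    have e1 : G i q j = lam i * u q j + mu i * c q j := hcf i q j
    have e2 : G q i j = lam q * u i j + mu q * c i j := hcf q i j
    have e3 : G i q j = G q i j := (h1 q i j).symm
    rw [e1, e2, hmui, hmu q hqj, hrow q j hqi hqj] at e3
    have e4 : lam q * u i j = 0 := by linear_combination -e3
    rcases mul_eq_zero.mp e4 with h | h
    · exact h
    · exact absurd h huij
  -- rows of `c` outside `{i,j}` vanish: read `G(j,q,r) = G(q,j,r)`
  intro q r hqi hqj
  have e1 : G j q r = lam j * u q r + mu j * c q r := hcf j q r
  have e2 : G q j r = lam q * u j r + mu q * c j r := hcf q j r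
  have e3 : G j q r = G q j r := (h1 q j r).symm
  rw [e1, e2, hlam q hqi hqj, hmu q hqj, hrow q r hqi hqj] at e3
  have e4 : mu j * c q r = 0 := by linear_combination e3
  rcases mul_eq_zero.mp e4 with h | h
  · exact absurd h hmuj
  · exact h

/-- ★★ (P1) **A PLANE `⟨x_ix_j, c⟩` WITH `c` NOT SUPPORTED ON THE BLOCK `{i,j}²` HAS NO NONZERO DIAGONAL-FREE PROLONGATION.** [folklore] -/
theorem diagFree_prolong_eq_zero_of_offBlock (u c : Fin 5 → Fin 5 → ℂ) (hu : ∀ p q, u p q = u q p) (hc : ∀ p q, c p q = c q p)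
    (i j : Fin 5) (hij : i ≠ j) (huij : u i j ≠ 0) (hoff : ∀ p q : Fin 5, u p q ≠ 0 → (p = i ∧ q = j) ∨ (p = j ∧ q = i))
    (hnb : ∃ q r : Fin 5, q ≠ i ∧ q ≠ j ∧ c q r ≠ 0)
    (G : Fin 5 → Fin 5 → Fin 5 → ℂ) (hG : G ∈ prolong (Submodule.span ℂ ({u, c} : Set (Fin 5 → Fin 5 → ℂ))))
    (hdf : ∀ p : Fin 5, G p p p = 0) : G = 0 := by
  classical
  obtain ⟨q₁, r₁, hq₁i, hq₁j, hcqr⟩ := hnb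
  have huji : u j i ≠ 0 := by rwa [hu j i]
  have hoff' : ∀ p q : Fin 5, u p q ≠ 0 → (p = j ∧ q = i) ∨ (p = i ∧ q = j) := fun p q h => (hoff p q h).symm
  by_contra hG0
  by_cases hci : c i i ≠ 0
  · exact hcqr (offBlock_zero_of_diagFree_prolong u c hu i j hij huij hoff hci G hG hdf hG0 q₁ r₁ hq₁i hq₁j)
  by_cases hcj : c j j ≠ 0
  · exact hcqr (offBlock_zero_of_diagFree_prolong u c hu j i hij.symm huji hoff' hcj G hG hdf hG0 q₁ r₁ hq₁j hq₁i)
  push Not at hci hcj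
  by_cases hdiag : ∃ q₀, c q₀ q₀ ≠ 0
  · obtain ⟨q₀, hq₀⟩ := hdiag
    have hq₀i : q₀ ≠ i := fun h => hq₀ (h ▸ hci)
    have hq₀j : q₀ ≠ j := fun h => hq₀ (h ▸ hcj)
    exact hG0 (diagFree_prolong_eq_zero_of_diag_off u c hu i j hij huij hoff q₀ hq₀i hq₀j hq₀ G hG hdf)
  · -- `c` zero-diagonal: `G` is square-free
    push Not at hdiag
    have hud : ∀ q, u q q = 0 := fun q => by
      by_contra h
      rcases hoff q q h with ⟨h1, h2⟩ | ⟨h1, h2⟩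
      · exact hij (h1.symm.trans h2)
      · exact hij (h2.symm.trans h1)
    have hUs : ∀ x ∈ Submodule.span ℂ ({u, c} : Set (Fin 5 → Fin 5 → ℂ)), ∀ p q : Fin 5, x p q = x q p := by
      intro x hx p q
      obtain ⟨c1, c2, rfl⟩ := Submodule.mem_span_pair.mp hx
      simp only [Pi.add_apply, Pi.smul_apply, smul_eq_mul, hu p q, hc p q]
    have hU2 : Module.finrank ℂ (Submodule.span ℂ ({u, c} : Set (Fin 5 → Fin 5 → ℂ))) ≤ 2 := by
      have h : Module.finrank ℂ (Submodule.span ℂ (↑({u, c} : Finset (Fin 5 → Fin 5 → ℂ)) : Set (Fin 5 → Fin 5 → ℂ))) ≤ 2 :=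
        (finrank_span_finset_le_card _).trans Finset.card_le_two
      have hset : (↑({u, c} : Finset (Fin 5 → Fin 5 → ℂ)) : Set (Fin 5 → Fin 5 → ℂ)) = {u, c} := by
        simp only [Finset.coe_insert, Finset.coe_singleton]
      rw [hset] at h
      exact h
    have hGp := hG
    rw [mem_prolong_iff] at hGp
    obtain ⟨h1, h2, hsl⟩ := hGp
    have hsq : ∀ p r, (G + 0) p p r = 0 := by
      intro p r
      rw [add_zero]
      have e : G p p r = G r p p := by rw [h2 p p r, h1 p r p]
      rw [e]
      obtain ⟨l, m, hlm⟩ := Submodule.mem_span_pair.mp (hsl r)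
      have e2 := congrFun (congrFun hlm p) p
      simp only [Pi.add_apply, Pi.smul_apply, smul_eq_mul, hud p, hdiag p, mul_zero, add_zero] at e2
      exact e2.symm
    have h3 : Module.finrank ℂ ↥(Submodule.span ℂ ({u, c} : Set (Fin 5 → Fin 5 → ℂ)) ⊔
        Submodule.span ℂ ({u, c} : Set (Fin 5 → Fin 5 → ℂ))) ≤ 3 := by
      rw [sup_idem]
      exact hU2.trans (by norm_num)
    have h := prolong_sup_sqfree_eq_zero _ _ hUs hUs hU2 hU2 h3 G 0 hG (Submodule.zero_mem _) hsq
    rw [add_zero] at h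
    exact hG0 h

/-- ★★ (P2) **PROLONGATION 4 FORCES THE BLOCK.**  `u` a pair monomial on `{i,j}`; `a, b` symmetric with
`4 ≤ finrank prolong(⟨u,a⟩ ⊔ ⟨u,b⟩)`.  Then `a` and `b` are supported on the block `{i,j} × {i,j}` (✓BN). [folklore] -/
theorem block_of_four_le_finrank_prolong (u a b : Fin 5 → Fin 5 → ℂ) (hu : ∀ p q, u p q = u q p)
    (ha : ∀ p q, a p q = a q p) (hb : ∀ p q, b p q = b q p)
    (i j : Fin 5) (hij : i ≠ j) (huij : u i j ≠ 0) (hoff : ∀ p q : Fin 5, u p q ≠ 0 → (p = i ∧ q = j) ∨ (p = j ∧ q = i))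
    (h4 : 4 ≤ Module.finrank ℂ (prolong (Submodule.span ℂ ({u, a} : Set (Fin 5 → Fin 5 → ℂ)) ⊔
      Submodule.span ℂ ({u, b} : Set (Fin 5 → Fin 5 → ℂ))))) :
    (∀ q r : Fin 5, q ≠ i → q ≠ j → a q r = 0) ∧ (∀ q r : Fin 5, q ≠ i → q ≠ j → b q r = 0) := by
  classical
  have huji : u j i ≠ 0 := by rwa [hu j i]
  have hud : ∀ q, u q q = 0 := fun q => by
    by_contra h
    rcases hoff q q h with ⟨h1, h2⟩ | ⟨h1, h2⟩
    · exact hij (h1.symm.trans h2)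
    · exact hij (h2.symm.trans h1)
  have hcol : ∀ q r, r ≠ i → r ≠ j → u q r = 0 := fun q r hri hrj => by
    by_contra h
    rcases hoff q r h with ⟨-, h2⟩ | ⟨-, h2⟩
    · exact hrj h2
    · exact hri h2
  -- the sum is symmetric of finrank ≤ 3
  have hsym2 : ∀ v : Fin 5 → Fin 5 → ℂ, (∀ p q, v p q = v q p) →
      ∀ x ∈ Submodule.span ℂ ({u, v} : Set (Fin 5 → Fin 5 → ℂ)), ∀ p q : Fin 5, x p q = x q p := by
    intro v hv x hx p q
    obtain ⟨c1, c2, rfl⟩ := Submodule.mem_span_pair.mp hx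
    simp only [Pi.add_apply, Pi.smul_apply, smul_eq_mul, hu p q, hv p q]
  have hXs : ∀ x ∈ Submodule.span ℂ ({u, a} : Set (Fin 5 → Fin 5 → ℂ)) ⊔ Submodule.span ℂ ({u, b} : Set (Fin 5 → Fin 5 → ℂ)),
      ∀ p q : Fin 5, x p q = x q p := by
    intro x hx p q
    obtain ⟨y, hy, z, hz, rfl⟩ := Submodule.mem_sup.mp hx
    show y p q + z p q = y q p + z q p
    rw [hsym2 a ha y hy p q, hsym2 b hb z hz p q]
  have hX3 : Module.finrank ℂ ↥(Submodule.span ℂ ({u, a} : Set (Fin 5 → Fin 5 → ℂ)) ⊔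
      Submodule.span ℂ ({u, b} : Set (Fin 5 → Fin 5 → ℂ))) ≤ 3 := by
    have hle : Submodule.span ℂ ({u, a} : Set (Fin 5 → Fin 5 → ℂ)) ⊔ Submodule.span ℂ ({u, b} : Set (Fin 5 → Fin 5 → ℂ)) ≤
        Submodule.span ℂ ({a} : Set (Fin 5 → Fin 5 → ℂ)) ⊔ Submodule.span ℂ ({u, b} : Set (Fin 5 → Fin 5 → ℂ)) := by
      refine sup_le ?_ le_sup_right
      rw [Submodule.span_le]
      intro x hx
      rcases hx with rfl | rfl
      · exact Submodule.mem_sup_right (Submodule.subset_span (by simp))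
      · exact Submodule.mem_sup_left (Submodule.subset_span rfl)
    refine (Submodule.finrank_mono hle).trans ((Submodule.finrank_add_le_finrank_add_finrank _ _).trans ?_)
    have h1 : Module.finrank ℂ (Submodule.span ℂ ({a} : Set (Fin 5 → Fin 5 → ℂ))) ≤ 1 := by
      have h1' : Module.finrank ℂ (Submodule.span ℂ (↑({a} : Finset (Fin 5 → Fin 5 → ℂ)) : Set (Fin 5 → Fin 5 → ℂ))) ≤ 1 :=
        (finrank_span_finset_le_card _).trans (Finset.card_singleton a).le
      have hset : (↑({a} : Finset (Fin 5 → Fin 5 → ℂ)) : Set (Fin 5 → Fin 5 → ℂ)) = {a} := Finset.coe_singleton a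
      rw [hset] at h1'
      exact h1'
    have h2 : Module.finrank ℂ (Submodule.span ℂ ({u, b} : Set (Fin 5 → Fin 5 → ℂ))) ≤ 2 := by
      have h : Module.finrank ℂ (Submodule.span ℂ (↑({u, b} : Finset (Fin 5 → Fin 5 → ℂ)) : Set (Fin 5 → Fin 5 → ℂ))) ≤ 2 :=
        (finrank_span_finset_le_card _).trans Finset.card_le_two
      have hset : (↑({u, b} : Finset (Fin 5 → Fin 5 → ℂ)) : Set (Fin 5 → Fin 5 → ℂ)) = {u, b} := by
        simp only [Finset.coe_insert, Finset.coe_singleton]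
      rw [hset] at h
      exact h
    omega
  -- BN: the rows lie in `P = ⟨u_i, u_j⟩`
  obtain ⟨p₀, hL, hrows⟩ := exists_rows_le_two_of_finrank_prolong _ hXs hX3 h4
  let P : Submodule ℂ (Fin 5 → ℂ) := Submodule.span ℂ (Set.range ![u i, u j])
  have hPind : LinearIndependent ℂ ![u i, u j] := by
    rw [LinearIndependent.pair_iff]
    intro s t hst
    have ej := congrFun hst j
    have ei := congrFun hst i
    simp only [Pi.add_apply, Pi.smul_apply, smul_eq_mul, Pi.zero_apply, hud j, hud i, mul_zero, add_zero, zero_add] at ej ei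
    constructor
    · rcases mul_eq_zero.mp ej with h | h
      · exact h
      · exact absurd h huij
    · rcases mul_eq_zero.mp ei with h | h
      · exact h
      · exact absurd h huji
  have hP2 : Module.finrank ℂ P = 2 := by
    have h := finrank_span_eq_card hPind
    simpa using h
  have huX : u ∈ Submodule.span ℂ ({u, a} : Set (Fin 5 → Fin 5 → ℂ)) ⊔ Submodule.span ℂ ({u, b} : Set (Fin 5 → Fin 5 → ℂ)) :=
    Submodule.mem_sup_left (Submodule.subset_span (by simp))
  have hPL : P ≤ rowIm (Submodule.span ℂ ({u, a} : Set (Fin 5 → Fin 5 → ℂ)) ⊔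
      Submodule.span ℂ ({u, b} : Set (Fin 5 → Fin 5 → ℂ))) p₀ := by
    rw [Submodule.span_le]
    rintro y ⟨k, rfl⟩
    fin_cases k
    · exact hrows u huX i
    · exact hrows u huX j
  have hPeq := Submodule.eq_of_le_of_finrank_le hPL (hL.trans hP2.ge)
  have hrange : Set.range ![u i, u j] = ({u i, u j} : Set (Fin 5 → ℂ)) := by
    ext v
    simp only [Set.mem_range, Set.mem_insert_iff, Set.mem_singleton_iff]
    constructor
    · rintro ⟨k, rfl⟩
      fin_cases k <;> simp
    · rintro (rfl | rfl)
      exacts [⟨0, by simp⟩, ⟨1, by simp⟩]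
  -- a row in `P` vanishes outside the columns `{i,j}`
  have hrowP : ∀ x ∈ Submodule.span ℂ ({u, a} : Set (Fin 5 → Fin 5 → ℂ)) ⊔ Submodule.span ℂ ({u, b} : Set (Fin 5 → Fin 5 → ℂ)),
      ∀ q r : Fin 5, r ≠ i → r ≠ j → x q r = 0 := by
    intro x hx q r hri hrj
    have hxq : x q ∈ P := by rw [hPeq]; exact hrows x hx q
    have hxq' : x q ∈ Submodule.span ℂ ({u i, u j} : Set (Fin 5 → ℂ)) := by rw [← hrange]; exact hxq
    obtain ⟨α, β, hαβ⟩ := Submodule.mem_span_pair.mp hxq'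
    have e := congrFun hαβ r
    simp only [Pi.add_apply, Pi.smul_apply, smul_eq_mul, hcol i r hri hrj, hcol j r hri hrj, mul_zero, add_zero] at e
    exact e.symm
  have haX : a ∈ Submodule.span ℂ ({u, a} : Set (Fin 5 → Fin 5 → ℂ)) ⊔ Submodule.span ℂ ({u, b} : Set (Fin 5 → Fin 5 → ℂ)) :=
    Submodule.mem_sup_left (Submodule.subset_span (by simp))
  have hbX : b ∈ Submodule.span ℂ ({u, a} : Set (Fin 5 → Fin 5 → ℂ)) ⊔ Submodule.span ℂ ({u, b} : Set (Fin 5 → Fin 5 → ℂ)) :=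
    Submodule.mem_sup_right (Submodule.subset_span (by simp))
  exact ⟨fun q r hqi hqj => by rw [ha q r]; exact hrowP a haX r q hqi hqj,
    fun q r hqi hqj => by rw [hb q r]; exact hrowP b hbX r q hqi hqj⟩


end LaplaceFiveSeparatedCapture

end Summit.ValiantsHypothesis.ValiantsHypothesis.Theorems.RigidityForcesSymmetryRankRigidMinimalRepr
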